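import Literature.AnabelianGeometry.SemiGraphs.TemperedCompactPairSeparatingEdge
import HarnessLib

/-!
# Two subgroups of `π₁^temp(𝒢)` at tree distance `≥ 2`: the separating vertex is crossed UNFOLDED by every walk
# between the fixed loci at every deeper level

Mochizuki, *Semi-graphs of anabelioids*, Publ. RIMS **42** (2006), §1, Lemma 1.8 (ii) p. 20, §3, Theorem 3.7
(iii)/(iv) pp. 40–41 [cite: MochizukiSemiAnbd2006, Thm 3.7(iv) p.41].

PROOF-ONLY tool file (abc-iut cell, layer L3, row «T37iv-S2@RELATIVE-BRIDGE», file F3b, seat abc-iut-L3-t8 gen 10;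
no definition, no named fact).  Third regime of the trichotomy (F1 `TemperedCompactPairBridgeRelative.lean`: the
level fixed loci of `K₁`, `K₂` always meet ⟺ `(K₁ ⊔ K₂)‾` compact; F2 `TemperedCompactPairDistanceOne.lean`: at
distance one from some level on ⟹ anchored).  Here `K₁`, `K₂` fix no common vertex of `𝒢_{∞,m}` and `𝒢_{∞,m}`
carries NO bridge (no edge with distinct branches abutting to a `K₁`-fixed and a `K₂`-fixed vertex).  For ANY
countable `𝒢` with the hypotheses of Prop. 3.6, canonical tower, ANY subgroups (no compactness, no estrangement):

* `exists_unfolded_crossing_of_separating_vertex` — one-sided engine: a vertex `z` of `𝒢_{∞,m}` not fixed by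
  `Q`, passed by every walk from a `Q`-fixed vertex to `a₀` and avoided from every `P`-fixed vertex, is crossed
  UNFOLDED at every level `M ≥ m` by every walk from a `P`-fixed to a `Q`-fixed vertex of `𝒢_{∞,M}` (crossing
  lemma of F3a for the transition on nodes);
* ★ `exists_unfolded_crossing` — no common fixed vertex and NO bridge at level `m` ⇒ there is a vertex `z` of
  `𝒢_{∞,m}` fixed by NEITHER `K₁` NOR `K₂` such that at EVERY level `M ≥ m` EVERY walk of `𝒢_{∞,M}` from a
  `K₁`-fixed to a `K₂`-fixed vertex contains a vertex `w̃` OVER `z` and two of its branches on the walk whose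
  images in `𝒢_{∞,m}` are DISTINCT branches at `z`;
* ★★ `anchored_or_unfolded_of_not_isCompact` — the TRICHOTOMY assembled (F1 + F2 + F3): for COMPACT `K₁`, `K₂`
  with `(K₁ ⊔ K₂)‾` NOT compact, EITHER both lie in verticial subgroups with `K₁ ⊓ K₂` in an edge-like subgroup
  (anchored, F2), OR there are a level `m` and a vertex `z` of `𝒢_{∞,m}` fixed by neither such that every
  `d ∈ K₁ ⊓ K₂` FIXES, at every level `M ≥ m`, a vertex over `z` together with two of its branches whose images
  are DISTINCT branches at `z` (Lemma 1.8 (ii)(b) on the geodesic between a `K₁`-fixed and a `K₂`-fixed vertex).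

This is the exact residual phenomenon behind any failure of the second sentence of Thm 3.7 (iv) in the cell's
∀-countable typing: PERSISTENT UNFOLDED FIXED BRANCH PAIRS over ONE level vertex.  Honest framing: generic
statements about OUR typed `π₁^temp`; nothing here bears on [IUTchIII] Cor. 3.12; no side taken; typed ≠ proved.
-/
noncomputable section

open CategoryTheory Topology

namespace Literature.AnabelianGeometry.SemiGraphs

open SimpleGraph

universe u

namespace ProfiniteSemiGraph

variable {𝒢 : ProfiniteSemiGraph.{u}}

/-! ### ★ Unfolded crossings at every deeper level -/

/-- **One-sided engine.**  Let `z` be a vertex of `𝒢_{∞,m}` not fixed by `Q` such that every walk from a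
`Q`-fixed vertex to `a₀` passes `z` while every `P`-fixed vertex reaches `a₀` avoiding `z`.  Then at every level
`M ≥ m` every walk of `𝒢_{∞,M}` from a `P`-fixed vertex to a `Q`-fixed vertex contains a vertex `w̃` over `z`
together with two of its branches on the walk whose images in `𝒢_{∞,m}` are DISTINCT branches at `z` (crossing
lemma for `f` = the transition on nodes, `c = z`, `D` = nodes reaching `a₀` avoiding `z`).
[cite: MochizukiSemiAnbd2006, Lem. 1.8(ii) p.20] -/
theorem exists_unfolded_crossing_of_separating_vertex (h36 : 𝒢.Prop36Hypotheses)
    (P Q : Subgroup ((𝒢.galoisLevelData h36).temperedPi h36.isCountable)) (m : ℕ)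
    (z a₀ : ((𝒢.galoisLevelData h36).tree m).Vertex)
    (hzQ : ¬ ∀ k ∈ Q, ((𝒢.galoisLevelData h36).treeAct h36.isCountable m k).hom.vertexMap z = z)
    (hQ : ∀ b : ((𝒢.galoisLevelData h36).tree m).Vertex,
      (∀ k ∈ Q, ((𝒢.galoisLevelData h36).treeAct h36.isCountable m k).hom.vertexMap b = b) →
      ∀ q : ((𝒢.galoisLevelData h36).tree m).subdivision.Walk (Sum.inl b) (Sum.inl a₀),
        (Sum.inl z : ((𝒢.galoisLevelData h36).tree m).Node) ∈ q.support)
    (hP : ∀ a : ((𝒢.galoisLevelData h36).tree m).Vertex,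
      (∀ k ∈ P, ((𝒢.galoisLevelData h36).treeAct h36.isCountable m k).hom.vertexMap a = a) →
      ∃ p : ((𝒢.galoisLevelData h36).tree m).subdivision.Walk (Sum.inl a) (Sum.inl a₀),
        (Sum.inl z : ((𝒢.galoisLevelData h36).tree m).Node) ∉ p.support)
    (M : ℕ) (hmM : m ≤ M) {v u : ((𝒢.galoisLevelData h36).tree M).Vertex}
    (hv : ∀ k ∈ P, ((𝒢.galoisLevelData h36).treeAct h36.isCountable M k).hom.vertexMap v = v)
    (hu : ∀ k ∈ Q, ((𝒢.galoisLevelData h36).treeAct h36.isCountable M k).hom.vertexMap u = u)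
    (γ : ((𝒢.galoisLevelData h36).tree M).subdivision.Walk (Sum.inl v) (Sum.inl u)) :
    ∃ (w : ((𝒢.galoisLevelData h36).tree M).Vertex) (β β' : ((𝒢.galoisLevelData h36).tree M).Branch),
      (Sum.inl w : ((𝒢.galoisLevelData h36).tree M).Node) ∈ γ.support ∧
      (Sum.inr (Sum.inr β) : ((𝒢.galoisLevelData h36).tree M).Node) ∈ γ.support ∧
      (Sum.inr (Sum.inr β') : ((𝒢.galoisLevelData h36).tree M).Node) ∈ γ.support ∧
      ((𝒢.galoisLevelData h36).tree M).abuts β = some w ∧ ((𝒢.galoisLevelData h36).tree M).abuts β' = some w ∧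
      ((𝒢.galoisLevelData h36).treeTrans hmM).vertexMap w = z ∧
      ((𝒢.galoisLevelData h36).treeTrans hmM).branchMap β ≠ ((𝒢.galoisLevelData h36).treeTrans hmM).branchMap β' := by
  classical
  let Dg := 𝒢.galoisLevelData h36
  have hc := h36.isCountable
  let D₀ : VerticialLevelData.{0} 𝒢 (𝒢.temperedPiChart h36) := verticialLevelData_temperedPiChart (h36 := h36)
  let T := Dg.tree m
  let π := Dg.treeTrans hmM
  have hpush : ∀ (K : Subgroup (Dg.temperedPi hc)) (x : (Dg.tree M).Vertex),
      (∀ k ∈ K, (Dg.treeAct hc M k).hom.vertexMap x = x) →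
      ∀ k ∈ K, (Dg.treeAct hc m k).hom.vertexMap (π.vertexMap x) = π.vertexMap x := by
    intro K x hx k hk
    have h : π.vertexMap ((Dg.treeAct hc M k).hom.vertexMap x) =
        (Dg.treeAct hc m k).hom.vertexMap (π.vertexMap x) := D₀.trans_act_vertexMap hmM k x
    rw [hx k hk] at h
    exact h.symm
  -- the set `D`: nodes of `𝒢_{∞,m}` reaching `a₀` avoiding `z`
  let c : T.Node := Sum.inl z
  let D : Set T.Node := {n | ∃ p : T.subdivision.Walk n (Sum.inl a₀), c ∉ p.support}
  have hD : ∀ n n' : T.Node, n ∈ D → T.subdivision.Adj n n' → n' ≠ c → n' ∈ D := by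
    rintro n n' ⟨p, hp⟩ hnn' hn'
    refine ⟨Walk.cons hnn'.symm p, ?_⟩
    rw [Walk.support_cons, List.mem_cons, not_or]
    exact ⟨fun h => hn' h.symm, hp⟩
  let f : (Dg.tree M).Node → T.Node := SemiGraph.Hom.nodeMap π
  have hf : ∀ x y, (Dg.tree M).subdivision.Adj x y → T.subdivision.Adj (f x) (f y) :=
    fun x y h => (Dg.tree M).subdivision_adj_map π h
  have hs : f (Sum.inl v) ∈ D := hP (π.vertexMap v) (hpush P v hv)
  have ht : f (Sum.inl u) ∉ D := by
    rintro ⟨p, hp⟩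
    exact hp (hQ (π.vertexMap u) (hpush Q u hu) p)
  have htc : f (Sum.inl u) ≠ c := by
    intro h
    have huz : π.vertexMap u = z := Sum.inl_injective h
    exact hzQ (huz ▸ hpush Q u hu)
  obtain ⟨g, g', g'', hg, hg', hg'', hgg', hg'g'', hgD, hg'c, hg''D, -⟩ :=
    SemiGraph.exists_crossing_of_walk f hf c D hD ht htc γ.length γ rfl hs
  -- `g'` is a vertex `w̃` over `z`; `g`, `g''` are branch points at `w̃` with distinct images
  rcases g' with w | e | b
  · have hw : π.vertexMap w = z := Sum.inl_injective hg'c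
    obtain ⟨β, hβ, rfl⟩ := ((Dg.tree M).subdivision_adj_inl_iff w g).mp hgg'.symm
    obtain ⟨β', hβ', rfl⟩ := ((Dg.tree M).subdivision_adj_inl_iff w g'').mp hg'g''
    refine ⟨w, β, β', hg', hg, hg'', hβ, hβ', hw, fun hββ' => hg''D ?_⟩
    have hfeq : f (Sum.inr (Sum.inr β)) = f (Sum.inr (Sum.inr β')) := by
      change (Sum.inr (Sum.inr (π.branchMap β)) : T.Node) = Sum.inr (Sum.inr (π.branchMap β'))
      rw [hββ']
    rw [← hfeq]
    exact hgD
  · exact absurd hg'c (by simp [f, c, SemiGraph.Hom.nodeMap])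
  · exact absurd hg'c (by simp [f, c, SemiGraph.Hom.nodeMap])

/-- ★ **UNFOLDED CROSSINGS (distance `≥ 2`).**  Let `K₁`, `K₂ ≤ π₁^temp(𝒢)` fix the vertices `a₀`, resp. `b₀`,
of `𝒢_{∞,m}`, fix NO common vertex of `𝒢_{∞,m}`, and suppose `𝒢_{∞,m}` carries NO bridge (no edge with
distinct branches abutting to a `K₁`-fixed and a `K₂`-fixed vertex).  Then there is a vertex `z` of `𝒢_{∞,m}`
fixed by NEITHER `K₁` NOR `K₂` such that, at EVERY level `M ≥ m`, EVERY walk of `𝒢_{∞,M}` from a `K₁`-fixed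
vertex to a `K₂`-fixed vertex contains a vertex `w̃` over `z` and two of its branches `β̃`, `β̃'` on the walk
whose images in `𝒢_{∞,m}` are DISTINCT branches at `z`.  (`z` = the vertex `z₁` of the `K₁`-side branch of the
separating edge if `K₁` does not fix it, else the vertex `z₂` of the `K₂`-side branch, which `K₂` cannot fix
for want of a bridge.) [cite: MochizukiSemiAnbd2006, Thm 3.7(iv) p.41] -/
theorem exists_unfolded_crossing (h36 : 𝒢.Prop36Hypotheses)
    (K₁ K₂ : Subgroup ((𝒢.galoisLevelData h36).temperedPi h36.isCountable)) (m : ℕ)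
    (hno : ∀ z : ((𝒢.galoisLevelData h36).tree m).Vertex,
      (∀ k ∈ K₁, ((𝒢.galoisLevelData h36).treeAct h36.isCountable m k).hom.vertexMap z = z) →
        ¬ ∀ k ∈ K₂, ((𝒢.galoisLevelData h36).treeAct h36.isCountable m k).hom.vertexMap z = z)
    (hnobr : ¬ ∃ (x y : ((𝒢.galoisLevelData h36).tree m).Vertex) (β₁ β₂ : ((𝒢.galoisLevelData h36).tree m).Branch),
      β₁ ≠ β₂ ∧ ((𝒢.galoisLevelData h36).tree m).edgeOf β₁ = ((𝒢.galoisLevelData h36).tree m).edgeOf β₂ ∧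
      ((𝒢.galoisLevelData h36).tree m).abuts β₁ = some x ∧ ((𝒢.galoisLevelData h36).tree m).abuts β₂ = some y ∧
      (∀ k ∈ K₁, ((𝒢.galoisLevelData h36).treeAct h36.isCountable m k).hom.vertexMap x = x) ∧
      ∀ k ∈ K₂, ((𝒢.galoisLevelData h36).treeAct h36.isCountable m k).hom.vertexMap y = y)
    {a₀ b₀ : ((𝒢.galoisLevelData h36).tree m).Vertex}
    (ha₀ : ∀ k ∈ K₁, ((𝒢.galoisLevelData h36).treeAct h36.isCountable m k).hom.vertexMap a₀ = a₀)
    (hb₀ : ∀ k ∈ K₂, ((𝒢.galoisLevelData h36).treeAct h36.isCountable m k).hom.vertexMap b₀ = b₀) :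
    ∃ z : ((𝒢.galoisLevelData h36).tree m).Vertex,
      (¬ ∀ k ∈ K₁, ((𝒢.galoisLevelData h36).treeAct h36.isCountable m k).hom.vertexMap z = z) ∧
      (¬ ∀ k ∈ K₂, ((𝒢.galoisLevelData h36).treeAct h36.isCountable m k).hom.vertexMap z = z) ∧
      ∀ (M : ℕ) (hmM : m ≤ M) (v u : ((𝒢.galoisLevelData h36).tree M).Vertex),
        (∀ k ∈ K₁, ((𝒢.galoisLevelData h36).treeAct h36.isCountable M k).hom.vertexMap v = v) →
        (∀ k ∈ K₂, ((𝒢.galoisLevelData h36).treeAct h36.isCountable M k).hom.vertexMap u = u) →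
        ∀ γ : ((𝒢.galoisLevelData h36).tree M).subdivision.Walk (Sum.inl v) (Sum.inl u),
          ∃ (w : ((𝒢.galoisLevelData h36).tree M).Vertex) (β β' : ((𝒢.galoisLevelData h36).tree M).Branch),
            (Sum.inl w : ((𝒢.galoisLevelData h36).tree M).Node) ∈ γ.support ∧
            (Sum.inr (Sum.inr β) : ((𝒢.galoisLevelData h36).tree M).Node) ∈ γ.support ∧
            (Sum.inr (Sum.inr β') : ((𝒢.galoisLevelData h36).tree M).Node) ∈ γ.support ∧
            ((𝒢.galoisLevelData h36).tree M).abuts β = some w ∧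
            ((𝒢.galoisLevelData h36).tree M).abuts β' = some w ∧
            ((𝒢.galoisLevelData h36).treeTrans hmM).vertexMap w = z ∧
            ((𝒢.galoisLevelData h36).treeTrans hmM).branchMap β ≠
              ((𝒢.galoisLevelData h36).treeTrans hmM).branchMap β' := by
  classical
  obtain ⟨e₀, b₁, b₂, z₁, z₂, h12, hb₁, hb₂, hz₁, hz₂, hsep, hp₁, hb₂R, hp₂, hb₁R⟩ :=
    exists_separating_edge_data h36 K₁ K₂ m hno ha₀ hb₀
  -- the separation property read from the side of `K₂`
  have hsep' : ∀ b a : ((𝒢.galoisLevelData h36).tree m).Vertex,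
      (∀ k ∈ K₂, ((𝒢.galoisLevelData h36).treeAct h36.isCountable m k).hom.vertexMap b = b) →
      (∀ k ∈ K₁, ((𝒢.galoisLevelData h36).treeAct h36.isCountable m k).hom.vertexMap a = a) →
      ∀ w : ((𝒢.galoisLevelData h36).tree m).subdivision.Walk (Sum.inl b) (Sum.inl a),
        (Sum.inr (Sum.inl e₀) : ((𝒢.galoisLevelData h36).tree m).Node) ∈ w.support := by
    intro b a hb ha w
    have h := hsep a b ha hb w.reverse
    rwa [Walk.support_reverse, List.mem_reverse] at h
  by_cases hz₁K : ∀ k ∈ K₁, ((𝒢.galoisLevelData h36).treeAct h36.isCountable m k).hom.vertexMap z₁ = z₁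
  · -- `z₁` is `K₁`-fixed: then `z₂` is not `K₂`-fixed (no bridge); work from the side of `K₂`
    have hz₂K : ¬ ∀ k ∈ K₂, ((𝒢.galoisLevelData h36).treeAct h36.isCountable m k).hom.vertexMap z₂ = z₂ :=
      fun h => hnobr ⟨z₁, z₂, b₁, b₂, h12, hb₁.trans hb₂.symm, hz₁, hz₂, hz₁K, h⟩
    obtain ⟨hz₂K₁, hQ, hP⟩ := separating_vertex_package h36 K₂ K₁ m h12.symm hb₂ hb₁ hz₂ hb₀ hsep' hp₂ hb₁R hz₂K
    refine ⟨z₂, hz₂K₁, hz₂K, fun M hmM v u hv hu γ => ?_⟩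
    obtain ⟨w, β, β', hw, hβ, hβ', hβw, hβ'w, hwz, hne⟩ :=
      exists_unfolded_crossing_of_separating_vertex h36 K₂ K₁ m z₂ b₀ hz₂K₁ hQ hP M hmM hu hv γ.reverse
    rw [Walk.support_reverse, List.mem_reverse] at hw hβ hβ'
    exact ⟨w, β, β', hw, hβ, hβ', hβw, hβ'w, hwz, hne⟩
  · -- `z₁` is not `K₁`-fixed: work from the side of `K₁`
    obtain ⟨hz₁K₂, hQ, hP⟩ := separating_vertex_package h36 K₁ K₂ m h12 hb₁ hb₂ hz₁ ha₀ hsep hp₁ hb₂R hz₁K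
    refine ⟨z₁, hz₁K, hz₁K₂, fun M hmM v u hv hu γ => ?_⟩
    exact exists_unfolded_crossing_of_separating_vertex h36 K₁ K₂ m z₁ a₀ hz₁K₂ hQ hP M hmM hv hu γ

/-! ### ★★ The trichotomy assembled -/

/-- **On a path between two vertices fixed by `g`, every vertex node and every branch node is fixed by `g`**
(Lemma 1.8 (ii)(b): the path is fixed node-wise). [cite: MochizukiSemiAnbd2006, Lem. 1.8(ii)(b) p.20] -/
theorem fixes_of_mem_support_path (h36 : 𝒢.Prop36Hypotheses) (M : ℕ)
    (g : (𝒢.galoisLevelData h36).temperedPi h36.isCountable) {v u : ((𝒢.galoisLevelData h36).tree M).Vertex}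
    (hv : ((𝒢.galoisLevelData h36).treeAct h36.isCountable M g).hom.vertexMap v = v)
    (hu : ((𝒢.galoisLevelData h36).treeAct h36.isCountable M g).hom.vertexMap u = u)
    (γ : ((𝒢.galoisLevelData h36).tree M).subdivision.Walk (Sum.inl v) (Sum.inl u)) (hγ : γ.IsPath) :
    (∀ w : ((𝒢.galoisLevelData h36).tree M).Vertex,
      (Sum.inl w : ((𝒢.galoisLevelData h36).tree M).Node) ∈ γ.support →
        ((𝒢.galoisLevelData h36).treeAct h36.isCountable M g).hom.vertexMap w = w) ∧
    ∀ β : ((𝒢.galoisLevelData h36).tree M).Branch,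
      (Sum.inr (Sum.inr β) : ((𝒢.galoisLevelData h36).tree M).Node) ∈ γ.support →
        ((𝒢.galoisLevelData h36).treeAct h36.isCountable M g).hom.branchMap β = β := by
  have hfix := SemiGraph.nodeMap_eq_self_of_isPath ((𝒢.galoisLevelData h36).isTree_tree M).isTree.isAcyclic
    ((𝒢.galoisLevelData h36).treeAct h36.isCountable M g) (by rw [SemiGraph.nodeMap_inl, hv])
    (by rw [SemiGraph.nodeMap_inl, hu]) γ hγ
  refine ⟨fun w hw => ?_, fun β hβ => ?_⟩
  · simpa only [SemiGraph.nodeMap_inl, Sum.inl.injEq] using hfix _ hw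
  · simpa only [SemiGraph.nodeMap_inr_inr, Sum.inr.injEq] using hfix _ hβ

/-- ★★ **THE TRICHOTOMY, assembled.**  Let `K₁, K₂ ≤ π₁^temp(𝒢)` be COMPACT with `(K₁ ⊔ K₂)‾` NOT compact.
Then EITHER `K₁`, `K₂` lie in verticial subgroups and `K₁ ⊓ K₂` in an edge-like subgroup (the anchored regime:
some level without common fixed vertex from which on every level carries a bridge —
`TemperedCompactPairDistanceOne.lean`), OR there are a level `m` and a vertex `z` of `𝒢_{∞,m}` fixed by NEITHER
`K₁` NOR `K₂` such that EVERY level `M ≥ m` carries a vertex `w̃` over `z` together with two branches at `w̃`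
whose images in `𝒢_{∞,m}` are DISTINCT branches at `z`, all three FIXED by EVERY `d ∈ K₁ ⊓ K₂` — a persistent
unfolded `K₁ ⊓ K₂`-fixed branch pair over ONE level vertex (`exists_unfolded_crossing` on the geodesic between a `K₁`-fixed and a `K₂`-fixed
vertex of `𝒢_{∞,M}`, fixed node-wise by `d`). [cite: MochizukiSemiAnbd2006, Thm 3.7(iv) p.41] -/
theorem anchored_or_unfolded_of_not_isCompact (h36 : 𝒢.Prop36Hypotheses)
    (K₁ K₂ : Subgroup ((𝒢.galoisLevelData h36).temperedPi h36.isCountable))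
    (hK₁ : IsCompact (K₁ : Set ((𝒢.galoisLevelData h36).temperedPi h36.isCountable)))
    (hK₂ : IsCompact (K₂ : Set ((𝒢.galoisLevelData h36).temperedPi h36.isCountable)))
    (hK : ¬ IsCompact (((K₁ ⊔ K₂).topologicalClosure :
      Subgroup ((𝒢.galoisLevelData h36).temperedPi h36.isCountable)) :
        Set ((𝒢.galoisLevelData h36).temperedPi h36.isCountable))) :
    ((∃ (v : 𝒢.graph.Vertex) (H : Subgroup (𝒢.temperedPiChart h36).G),
        H ∈ verticialSubgroups (𝒢.temperedPiChart h36) v ∧ K₁ ≤ H) ∧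
      (∃ (v : 𝒢.graph.Vertex) (H : Subgroup (𝒢.temperedPiChart h36).G),
        H ∈ verticialSubgroups (𝒢.temperedPiChart h36) v ∧ K₂ ≤ H) ∧
      ∃ (e : 𝒢.graph.Edge) (L : Subgroup (𝒢.temperedPiChart h36).G),
        L ∈ edgeLikeSubgroups (𝒢.temperedPiChart h36) e ∧ K₁ ⊓ K₂ ≤ L) ∨
    ∃ (m : ℕ) (z : ((𝒢.galoisLevelData h36).tree m).Vertex),
      (¬ ∀ k ∈ K₁, ((𝒢.galoisLevelData h36).treeAct h36.isCountable m k).hom.vertexMap z = z) ∧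
      (¬ ∀ k ∈ K₂, ((𝒢.galoisLevelData h36).treeAct h36.isCountable m k).hom.vertexMap z = z) ∧
      ∀ (M : ℕ) (hmM : m ≤ M),
        ∃ (w : ((𝒢.galoisLevelData h36).tree M).Vertex) (β β' : ((𝒢.galoisLevelData h36).tree M).Branch),
          ((𝒢.galoisLevelData h36).tree M).abuts β = some w ∧ ((𝒢.galoisLevelData h36).tree M).abuts β' = some w ∧
          ((𝒢.galoisLevelData h36).treeTrans hmM).vertexMap w = z ∧
          ((𝒢.galoisLevelData h36).treeTrans hmM).branchMap β ≠
            ((𝒢.galoisLevelData h36).treeTrans hmM).branchMap β' ∧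
          ∀ d ∈ K₁ ⊓ K₂,
            ((𝒢.galoisLevelData h36).treeAct h36.isCountable M d).hom.vertexMap w = w ∧
            ((𝒢.galoisLevelData h36).treeAct h36.isCountable M d).hom.branchMap β = β ∧
            ((𝒢.galoisLevelData h36).treeAct h36.isCountable M d).hom.branchMap β' = β' := by
  classical
  let Dg := 𝒢.galoisLevelData h36
  have hc := h36.isCountable
  let D₀ : VerticialLevelData.{0} 𝒢 (𝒢.temperedPiChart h36) := verticialLevelData_temperedPiChart (h36 := h36)
  -- some level `m` without a common fixed vertex (F1)
  obtain ⟨m, hm⟩ : ∃ m : ℕ, ∀ z : (Dg.tree m).Vertex,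
      (∀ k ∈ K₁, (Dg.treeAct hc m k).hom.vertexMap z = z) → ¬ ∀ k ∈ K₂, (Dg.treeAct hc m k).hom.vertexMap z = z := by
    by_contra h
    push Not at h
    exact hK (isCompact_topologicalClosure_sup_of_forall_exists_common_fixed_vertex h36 K₁ K₂
      fun m => by obtain ⟨z, hz₁, hz₂⟩ := h m; exact ⟨z, hz₁, hz₂⟩)
  by_cases hbr : ∀ M : ℕ, m ≤ M → ∃ (x y : (Dg.tree M).Vertex) (β₁ β₂ : (Dg.tree M).Branch), β₁ ≠ β₂ ∧
      (Dg.tree M).edgeOf β₁ = (Dg.tree M).edgeOf β₂ ∧ (Dg.tree M).abuts β₁ = some x ∧ (Dg.tree M).abuts β₂ = some y ∧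
      (∀ k ∈ K₁, (Dg.treeAct hc M k).hom.vertexMap x = x) ∧ ∀ k ∈ K₂, (Dg.treeAct hc M k).hom.vertexMap y = y
  · -- bridges at every level `M ≥ m`: the anchored regime (F2)
    left
    obtain ⟨h₁, h₂⟩ := exists_verticial_ge_of_forall_exists_bridge h36 K₁ K₂ m hm hbr
    exact ⟨h₁, h₂, exists_edgeLike_ge_inf_of_forall_exists_bridge h36 K₁ K₂ m hm hbr⟩
  · -- some level `M₀ ≥ m` without a bridge: unfolded crossings from `M₀` on
    right
    push Not at hbr
    obtain ⟨M₀, hmM₀, hnobr⟩ := hbr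
    have hno₀ : ∀ z : (Dg.tree M₀).Vertex, (∀ k ∈ K₁, (Dg.treeAct hc M₀ k).hom.vertexMap z = z) →
        ¬ ∀ k ∈ K₂, (Dg.treeAct hc M₀ k).hom.vertexMap z = z :=
      fun z hz => forall_not_common_fixed_of_le h36 K₁ K₂ hmM₀ hm z hz
    obtain ⟨a₀, ha₀⟩ := D₀.exists_forall_mem_fixed_vertex_of_isCompact K₁ hK₁ M₀
    obtain ⟨b₀, hb₀⟩ := D₀.exists_forall_mem_fixed_vertex_of_isCompact K₂ hK₂ M₀
    obtain ⟨z, hz₁, hz₂, hcross⟩ := exists_unfolded_crossing h36 K₁ K₂ M₀ hno₀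
      (fun ⟨x, y, β₁, β₂, h12, he, hx, hy, hxK, hyK⟩ => by
        obtain ⟨k, hk, hne⟩ := hnobr x y β₁ β₂ h12 he hx hy hxK
        exact hne (hyK k hk)) ha₀ hb₀
    refine ⟨M₀, z, hz₁, hz₂, fun M hM => ?_⟩
    obtain ⟨v, hv⟩ := D₀.exists_forall_mem_fixed_vertex_of_isCompact K₁ hK₁ M
    obtain ⟨u, hu⟩ := D₀.exists_forall_mem_fixed_vertex_of_isCompact K₂ hK₂ M
    obtain ⟨γ, hγp, -⟩ := ((Dg.isTree_tree M).isTree.connected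
      (Sum.inl v : (Dg.tree M).Node) (Sum.inl u)).exists_path_of_dist
    obtain ⟨w, β, β', hw, hβ, hβ', hβw, hβ'w, hwz, hne⟩ := hcross M hM v u hv hu γ
    refine ⟨w, β, β', hβw, hβ'w, hwz, hne, fun d hd => ?_⟩
    obtain ⟨hd₁, hd₂⟩ := Subgroup.mem_inf.mp hd
    obtain ⟨hfixV, hfixB⟩ := fixes_of_mem_support_path h36 M d (hv d hd₁) (hu d hd₂) γ hγp
    exact ⟨hfixV w hw, hfixB β hβ, hfixB β' hβ'⟩

end ProfiniteSemiGraph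

end Literature.AnabelianGeometry.SemiGraphs

end
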